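import Mathlib
import Literature.AlgebraicGeometry.Resolution.RegularLocalOrderValuation
import Summits.ResolutionOfSingularities.ResolutionOfSingularities.Theorems.WeightedInvariantHypersurfaceLocalGameEFT3
import Summits.ResolutionOfSingularities.ResolutionOfSingularities.Theorems.WeightedInvariantContactFiltrationCanonical
import HarnessLib

/-!
# The intrinsic CENTRE FILTRATION `jContact` of the position-dimension rungs P1 ∪ P2 of the key
# `LocalWeightedDropEFT4S` (door `HypersurfaceCentreConstruction`, stmt-ResolutionOfSingularities-19897) — DEFINITIONS

Topic: `Summits/ResolutionOfSingularities/ResolutionOfSingularities/Theorems`. Helper for the door item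
`HypersurfaceCentreConstruction` (statement `stmt-ResolutionOfSingularities-19897`, route `WeightedInvariant`), line
`local-engine` of res-L1-w43-plan-1 (L W4.3), RULING gen 9 #4 (3) **ORDER (o24-D)** (2026-08-27T07:58:51Z): «the
DEFINITION module … = the sketch's defs `contactFiltration` (078's inline `⨆` NAMED, + `rfl` bridge so p511384 rewrites
in one line) / `IsMonomialType` / `Reaches` / `bMax` / `jContactLocal` / `jContact`», planner sketch
`L/res-L1-w43-plan-1/p2_jdef_sketch_v1.lean` sha16 `f0caf299c7c77cc1` (CRUX-PLAN §v8). Typer res-type-092.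

[OURS · L1 W4.3] Replaces the role of NO printed item; NOT a statement of the manuscript
[claim: Hironaka2017, status: under-review]. AI work, weaker than expert review. DEFINITIONS ONLY (objects of the line,
nothing is asserted); the six target theorems of (o24-D) (`jContact_isoInvariant`, `jContact_unitInvariant`,
`jContact_eq_pow_of_DVR`, `jContact_of_eq_unit_mul_pow`, `jContact_eq_contactFiltration`, `one_le_bMax_and_reaches`)
live in the def-free siblings `…ContactCentreFiltrationBasic.lean` (any local ring: transport, (c6-J), (c12a-J)) and
`…ContactCentreFiltrationRegular.lean` (regular local rings: CASE A, DVR, CASE B, the K6 family).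

## The objects (one class function `J : (R : Type) → [CommRing R] → R → ℕ → Ideal R` for ALL positions of Krull
## dimension ≤ 2; dimension ≥ 3 = regime P3 is NOT claimed)

* `contactFiltration g b n = ⨆ j, (g^j) · 𝔪^{n - b j}` — the CONTACT FILTRATION of `g ∈ 𝔪` with weight `b` («the
  monomials `x^i g^j` with `i + b j ≥ n`» without naming a transversal `x`); the inline `⨆` of res-type-078's canonicity
  file `…ContactFiltrationCanonical` (p511384: C1 `weightedMonomialIdeal ![x, g] ![1, b] n = ⨆ …`, C2
  `contactFiltration_eq_of_mem`), named; `contactFiltration_def` is the `rfl` bridge.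
* `IsMonomialType f` — `f = v · g^ν`, `v` a unit, `g ∈ 𝔪 ∖ 𝔪²` (every non-zero non-unit of a DVR; CASE A of the
  dimension-two move table of res-type-073 / res-type-098).
* `Reaches f ν b` — some contact parameter `g ∈ 𝔪 ∖ 𝔪²` carries `f` to level `b ν` of its weight-`b` filtration;
  `bMax f = sSup {b ≥ 1 | Reaches f (ord f) b}` — the terminal contact level (junk `0` when the set is unbounded, which
  happens exactly off the monomial type only on NON-excellent rings, or empty).
* `jContactLocal f m` (local rings) — UNIFORM JUNK FIRST: `f = 0 ↦ ⊥`, `f` a unit `↦ ⊤` (design note (R4)); then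
  MONOMIAL TYPE ↦ `(√(f))^m` (= `(g)^m`; P1's adopted `jRad`, = `𝔪^m` at the non-zero non-units of a DVR); otherwise
  `𝔪^m ⊔ ⨆_{g maximiser} contactFiltration g (bMax f) m`, the supremum over ALL contact parameters `g` carrying `f` to the
  terminal level — CHOICE-FREE (design note (R1)); `jContact R f m` — the same on local rings, `⊤` off local rings (junk,
  as `iotaOrd`).

DESIGN NOTE (R1) (posted on the cell's STATUS 2026-08-27T08:06:47Z; res-type-070 INPUT 08:01:57Z and res-type-078 REVIEW
08:05:35Z independently; plan-1 CONSENT 08:07:54Z): the sketch's contact branch `contactFiltration (Classical.choose h.2)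
(bMax f) m` (else `𝔪^m`) is replaced by the supremum over all maximisers joined with `𝔪^m`.  The VALUE is the same at
every position — when a maximiser exists the supremum equals the filtration of ANY maximiser (canonicity C2 for
`bMax ≥ 2`, `contactFiltration_one_eq_pow` for `bMax = 1`, `= 𝔪^m` for `bMax = 0`; theorem `jContact_eq_contactFiltration`
of the sibling files) and when none exists it is the sketch's fallback `𝔪^m` — but the clauses `JIsoInvariant jContact`,
`JUnitInvariant jContact` (which quantify over EVERY commutative ring) become pure transport of structure, with no appeal
to canonicity on non-regular local rings.
DESIGN NOTE (R4) (res-type-078 REVIEW #2 08:21:32Z, adopted): the junk values are UNIFORM and decided FIRST — `J(0) = ⊥`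
and `J(unit) = ⊤` on every local ring — because the restricted clause (c11)↾≤2 (`IotaJEssSmoothCompatibleLE2`,
`…EFT4SDimLETwo`) quantifies over ALL `f` and over dimension jumps `S → S'` (a field or a DVR into a surface germ with
`𝔪 S' ≠ 𝔪'`), where the sketch's fallback `𝔪^m` would not extend (`(𝔪_S S')^m ≠ 𝔪_{S'}^m`); `⊥` and `⊤` extend along
every ring map, and `0` / units are preserved by the local homomorphisms in play.

## References

* H. Hironaka, *Characteristic polyhedra of singularities*, J. Math. Kyoto Univ. 7 (1967) 251–293. [Hironaka1967]
* V. Cossart, U. Jannsen, S. Saito, *Desingularization: invariants and strategy*, LNM 2270 (2020), Ch. 8 (maximal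
  contact in dimension two via the `δ`-invariant / first slope). [CossartJannsenSaito2020]
* res-L1-w43-plan-1, `CRUX-PLAN.md` §v8 + `p2_jdef_sketch_v1.lean` (OURS, AI planning).
-/

noncomputable section

open IsLocalRing Literature.AlgebraicGeometry.Resolution

set_option linter.dupNamespace false -- mandated namespace of this single-conjunct summit

namespace Summit.ResolutionOfSingularities.ResolutionOfSingularities.Cruxes.HypersurfaceCentreConstruction.LocalEngine

universe u

variable {S : Type u} [CommRing S]

/-! ## The contact filtration -/

/-- [OURS · (o24-D)] **The contact filtration** of `g` with weight `b`: degree `n` is `⨆ j, (g^j) · 𝔪^{n - b j}` — the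
ideal generated by the «monomials `x^α g^j` with `|α| + b j ≥ n`» for any regular system `(x, g)`, written without the
transversal parameters (res-type-078's inline `⨆` of `…ContactFiltrationCanonical`, named).
[cite: Hironaka1967, §1] -/
def contactFiltration [IsLocalRing S] (g : S) (b n : ℕ) : Ideal S :=
  ⨆ j, Ideal.span {g ^ j} * maximalIdeal S ^ (n - b * j)

/-- The `rfl` bridge to the inline `⨆` of `…ContactFiltrationCanonical` (p511384): every C1/C2/C3 lemma there rewrites
along it. [folklore] -/
theorem contactFiltration_def [IsLocalRing S] (g : S) (b n : ℕ) :
    contactFiltration g b n = ⨆ j, Ideal.span {g ^ j} * maximalIdeal S ^ (n - b * j) := rfl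

/-! ## Monomial type, reached levels, the terminal level -/

/-- [OURS · (o24-D)] `f` is of **monomial type**: a unit times a power of a regular parameter, `f = v · g^ν` with `v` a
unit and `g ∈ 𝔪 ∖ 𝔪²` (CASE A of the dimension-two move table; every non-zero non-unit of a discrete valuation ring;
`ν = 0` — units — allowed); a predicate of the line, not a cited statement. -/
def IsMonomialType [IsLocalRing S] (f : S) : Prop :=
  ∃ (v g : S) (ν : ℕ), IsUnit v ∧ g ∈ maximalIdeal S ∧ g ∉ maximalIdeal S ^ 2 ∧ f = v * g ^ ν

/-- [OURS · (o24-D)] Level `b` of the contact ladder is **reached** by `f` (of order `ν`): some contact parameter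
`g ∈ 𝔪 ∖ 𝔪²` has `f ∈ contactFiltration g b (b ν)` («the Newton polygon of `f` in coordinates `(x, g)` has first slope
`≥ b`», cf. Cossart–Jannsen–Saito LNM 2270 Ch. 8); a predicate of the line, not a cited statement. -/
def Reaches [IsLocalRing S] (f : S) (ν b : ℕ) : Prop :=
  ∃ g : S, g ∈ maximalIdeal S ∧ g ∉ maximalIdeal S ^ 2 ∧ f ∈ contactFiltration g b (b * ν)

/-- [OURS · (o24-D)] **The terminal contact level** `b_max(f) = sSup {b ≥ 1 | Reaches f (ord f) b}` (`ord f = adicOrder f`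
read in `ℕ`, `⊤ ↦ 0`); junk `0` when the set of reached levels is empty or unbounded (`Nat.sSup`).  At a position not of
monomial type of an EXCELLENT regular local ring the set is non-empty and bounded (termination of steepening, K6 of
`…EFTDimTwoContact`; theorem `one_le_bMax_and_reaches` of the sibling file). [cite: CossartJannsenSaito2020, Ch. 8] -/
def bMax [IsLocalRing S] (f : S) : ℕ :=
  sSup {b : ℕ | 1 ≤ b ∧ Reaches f (adicOrder f).toNat b}

/-! ## The centre filtration -/

open Classical in
/-- [OURS · (o24-D)] **The centre filtration at a local ring**: uniform junk first — `0 ↦ ⊥`, units `↦ ⊤` (design note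
(R4)); then MONOMIAL TYPE `f ↦ (√(f))^m` (= `(g)^m` for `f = v g^ν`, `ν ≥ 1`, in a regular local ring — P1's adopted
`jRad`, CASE A of dimension two); otherwise `𝔪^m ⊔ ⨆_{g} contactFiltration g (bMax f) m`, the supremum over ALL contact
parameters `g ∈ 𝔪 ∖ 𝔪²` carrying `f` to the terminal level `bMax f · ord f` — choice-free (design note (R1); equal to the
filtration of any single maximiser in a regular local ring, and to `𝔪^m` when there is none).
[OURS · L1 W4.3 · rung P2 candidate] -/
def jContactLocal [IsLocalRing S] (f : S) (m : ℕ) : Ideal S :=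
  if f = 0 then ⊥
  else if IsUnit f then ⊤
  else if IsMonomialType f then ((Ideal.span {f}).radical) ^ m
  else maximalIdeal S ^ m ⊔
    ⨆ (g : S) (_ : g ∈ maximalIdeal S ∧ g ∉ maximalIdeal S ^ 2 ∧
      f ∈ contactFiltration g (bMax f) (bMax f * (adicOrder f).toNat)), contactFiltration g (bMax f) m

open Classical in
/-- [OURS · (o24-D) · candidate] **THE INTRINSIC CENTRE FILTRATION `J` of the rungs P1 ∪ P2** of the key
`LocalWeightedDropEFT4S`, in the binder shape `(R : Type) → [CommRing R] → R → ℕ → Ideal R` of the clauses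
`JIsoInvariant` / `JUnitInvariant` / `CanonicalGameClause` (`…LocalGameEFT3`): `jContactLocal` on local rings, `⊤` off
local rings (junk, as `iotaOrd`).  NOT claimed to serve in Krull dimension ≥ 3 (regime P3). [OURS · L1 W4.3] -/
def jContact (R : Type u) [CommRing R] (f : R) (m : ℕ) : Ideal R :=
  if h : IsLocalRing R then @jContactLocal R _ h f m else ⊤

/-! ## Unfolding lemmas -/

/-- On a local ring `jContact R f m = jContactLocal f m`. [folklore] -/
theorem jContact_eq (R : Type u) [CommRing R] [h : IsLocalRing R] (f : R) (m : ℕ) :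
    jContact R f m = jContactLocal f m := by
  unfold jContact
  rw [dif_pos h]

/-- Off the local rings `jContact R f m = ⊤` (junk). [folklore] -/
theorem jContact_of_not_isLocalRing (R : Type u) [CommRing R] (h : ¬ IsLocalRing R) (f : R) (m : ℕ) :
    jContact R f m = ⊤ := by
  unfold jContact
  rw [dif_neg h]

/-- Junk: `jContactLocal 0 m = ⊥`. [folklore] -/
theorem jContactLocal_zero [IsLocalRing S] (m : ℕ) : jContactLocal (0 : S) m = ⊥ := by
  unfold jContactLocal
  rw [if_pos rfl]

/-- Junk: `jContactLocal f m = ⊤` for a unit `f`. [folklore] -/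
theorem jContactLocal_of_isUnit [IsLocalRing S] {f : S} (hf : IsUnit f) (m : ℕ) : jContactLocal f m = ⊤ := by
  unfold jContactLocal
  rw [if_neg hf.ne_zero, if_pos hf]

/-- The monomial-type branch (at a non-zero non-unit): `jContactLocal f m = (√(f))^m`. [folklore] -/
theorem jContactLocal_of_isMonomialType [IsLocalRing S] {f : S} (hf0 : f ≠ 0) (hfu : ¬ IsUnit f)
    (hf : IsMonomialType f) (m : ℕ) : jContactLocal f m = ((Ideal.span {f}).radical) ^ m := by
  unfold jContactLocal
  rw [if_neg hf0, if_neg hfu, if_pos hf]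

/-- The contact branch (at a non-zero non-unit off the monomial type):
`jContactLocal f m = 𝔪^m ⊔ ⨆_{g maximiser} contactFiltration g (bMax f) m`. [folklore] -/
theorem jContactLocal_of_not_isMonomialType [IsLocalRing S] {f : S} (hf0 : f ≠ 0) (hfu : ¬ IsUnit f)
    (hf : ¬ IsMonomialType f) (m : ℕ) :
    jContactLocal f m = maximalIdeal S ^ m ⊔
      ⨆ (g : S) (_ : g ∈ maximalIdeal S ∧ g ∉ maximalIdeal S ^ 2 ∧
        f ∈ contactFiltration g (bMax f) (bMax f * (adicOrder f).toNat)), contactFiltration g (bMax f) m := by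
  unfold jContactLocal
  rw [if_neg hf0, if_neg hfu, if_neg hf]

/-- The terminal level unfolds: `bMax f = sSup {b | 1 ≤ b ∧ Reaches f (adicOrder f).toNat b}`. [folklore] -/
theorem bMax_def [IsLocalRing S] (f : S) : bMax f = sSup {b : ℕ | 1 ≤ b ∧ Reaches f (adicOrder f).toNat b} := rfl

end Summit.ResolutionOfSingularities.ResolutionOfSingularities.Cruxes.HypersurfaceCentreConstruction.LocalEngine

end
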